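import Summits.HubbardSuperconductivity.HubbardSuperconductivity.Theses.ChiralWindow
import Summits.HubbardSuperconductivity.HubbardSuperconductivity.Theorems.ChiralWindowCwSsbToEvenTorusLROSplitGlue
import Literature.MathematicalPhysics.QuantumLattice.PairFieldMomentum
import HarnessLib

/-!
Scratch (lead c6): the split children exactly as the strategist's package files them (fully qualified, in the route
namespace), and the kernel check that the LANDED `Theses.ChiralWindow`-free glue (p139533) closes the generated glue
statement as a BARE CONSTANT — the shape `route edit --split … --glue-by <decl>` needs.
-/

namespace Summit.HubbardSuperconductivity.HubbardSuperconductivity.Theses.ChiralWindow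

open scoped BigOperators Topology Manifold Classical MeasureTheory ProbabilityTheory Matrix InnerProductSpace ComplexConjugate ContinuousMap
open Filter Set Function TopologicalSpace MeasureTheory

/-- child 1 (thermodynamic residue S2' = grand-canonical repelled chord floor, "GRC"). -/
def CwGcRepelledChordFloor : Prop :=
  ∃ U₀ : ℝ, 0 < U₀ ∧ ∀ U ∈ Set.Ioo (0:ℝ) U₀, ∀ δ ∈ Set.Ioo (0:ℝ) (1 / 2), ∀ μ : ℝ, Filter.Tendsto (fun L : ℕ => ((Literature.MathematicalPhysics.QuantumLattice.hubbardTorusWith 2 (L + 1) 1 U μ).groundStateFunctional Literature.MathematicalPhysics.QuantumLattice.totalNumber).re / ((L + 1 : ℕ) : ℝ) ^ 2) Filter.atTop (nhds (1 - δ)) → Literature.MathematicalPhysics.QuantumLattice.HasDWaveOrder U μ → ∃ a : ℝ, 0 < a ∧ ∀ R : ℕ, 0 < R → ∃ κ : ℝ, 0 < κ ∧ ∀ᶠ k : ℕ in Filter.atTop, κ * a * ((2 * k + 1 + 1 : ℕ) : ℝ) ^ 2 ≤ (Literature.MathematicalPhysics.QuantumLattice.hubbardTorusWith 2 (2 * k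 + 1 + 1) 1 U μ + (κ : ℂ) • (((((R : ℝ) ^ 4)⁻¹ : ℝ) : ℂ) • ∑ a : Literature.Probability.LatticeModels.TorusSite 2 (2 * k + 1 + 1), (∑ u : Fin 2 → Fin R, Literature.MathematicalPhysics.QuantumLattice.localPair Literature.MathematicalPhysics.QuantumLattice.dWaveFormFactor (2 * k + 1 + 1) (a + fun i => ((u i : ℕ) : ZMod (2 * k + 1 + 1))))ᴴ * (∑ u : Fin 2 → Fin R, Literature.MathematicalPhysics.QuantumLattice.localPair Literature.MathematicalPhysics.QuantumLattice.dWaveFormFactor (2 * k + 1 + 1) (a + fun i => ((u i : ℕ) : ZMod (2 * k + 1 + 1)))))).groundEnergy - (Literature.MathematicalPhysics.QuantumLattice.hubbardTorusWith 2 (2 * k + 1 + 1) 1 U μ).groundEnergy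

/-- child 2 (infrared residue S7 = guarded weak-coupling pointwise infrared leak). -/
def CwInfraredLeak : Prop :=
  ∃ U₀ : ℝ, 0 < U₀ ∧ ∀ U ∈ Set.Ioo (0:ℝ) U₀, ∀ δ ∈ Set.Ioo (0:ℝ) (1 / 2), ∀ μ : ℝ, Filter.Tendsto (fun L : ℕ => ((Literature.MathematicalPhysics.QuantumLattice.hubbardTorusWith 2 (L + 1) 1 U μ).groundStateFunctional Literature.MathematicalPhysics.QuantumLattice.totalNumber).re / ((L + 1 : ℕ) : ℝ) ^ 2) Filter.atTop (nhds (1 - δ)) → Literature.MathematicalPhysics.QuantumLattice.HasDWaveOrder U μ → ∀ b : ℝ, 0 < b → ∃ η : ℝ, 0 < η ∧ ∀ᶠ k : ℕ in Filter.atTop, ∀ ψ : Literature.MathematicalPhysics.QuantumLattice.Fock (Literature.MathematicalPhysics.QuantumLattice.Orb (Literature.MathematicalPhysics.QuantumLattice.FermionTorus 2 (2 * k + 1 + 1))), Literature.MathematicalPhysics.QuantumLattice.IsGroundStateInSector (Literature.MathematicalPhysics.QuantumLattice.hubbardTorus 2 (2 * k + 1 + 1) 1 U) (2 * ⌊(1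 - δ) * ((2 * k + 1 + 1 : ℕ) : ℝ) ^ 2 / 2⌋₊) 0 ψ → star ψ ⬝ᵥ ψ = 1 → (∑ m ∈ (Finset.univ.filter fun m : Literature.Probability.LatticeModels.TorusSite 2 (2 * k + 1 + 1) => m ≠ 0 ∧ Literature.MathematicalPhysics.QuantumLattice.momentumNormSq (2 * k + 1 + 1) m < η ^ 2), Literature.MathematicalPhysics.QuantumLattice.pairStructureFactor Literature.MathematicalPhysics.QuantumLattice.dWaveFormFactor (2 * k + 1 + 1) ψ m) / ((2 * k + 1 + 1 : ℕ) : ℝ) ^ 2 ≤ b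

/-- The generated glue item's statement, closed by the LANDED Theses-free constant (p139533): `--glue-by` shape. -/
theorem CwSsbToEvenTorusLROGlue : CwGcRepelledChordFloor → CwInfraredLeak → CwSsbToEvenTorusLRO :=
  Summit.HubbardSuperconductivity.HubbardSuperconductivity.Theorems.CwSsbToEvenTorusLRO.splitGlue_of_gcRepelledChordFloor_of_infraredLeak

/-- The alternative family {C₁, stmt-1089 by name}. -/
theorem CwSsbToEvenTorusLROGlue' : CwGcRepelledChordFloor → Summit.HubbardSuperconductivity.HubbardSuperconductivity.Theses.KacWindowPenalty.WindowInfraredBound → CwSsbToEvenTorusLRO :=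
  Summit.HubbardSuperconductivity.HubbardSuperconductivity.Theorems.CwSsbToEvenTorusLRO.splitGlue_of_gcRepelledChordFloor_of_windowInfraredBound

end Summit.HubbardSuperconductivity.HubbardSuperconductivity.Theses.ChiralWindow
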